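import Mathlib
import Literature.Analysis.ODE.InverseSquareLadder
import Literature.Analysis.PDE.Wave1DIntertwining
import HarnessLib

/-!
# The Darboux ladder maps free waves to solutions of `ψ_tt − ψ_xx + n(n+1) ι² ψ = 0`

Analysis/PDE support file (everything proved). Iterating `Literature.Analysis.PDE.wave1D_intertwine`
along the ladder `ladder ι n = (∂ₓ − nι) ∘ ⋯ ∘ (∂ₓ − ι)` (`InverseSquareLadder.lean`): if `ι` is smooth
with `ι' = −ι²` on an open set `S` (e.g. `ι = 1/(x−x₀)` on `x > x₀`) and `Φ` is a `C^{n+2}` solution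
of the free 1+1 wave equation on `ℝ²`, then `ψ(t, ·) = ladder ι n (Φ(t, ·))` is jointly `C²` and solves
`ψ_tt = ψ_xx − n(n+1) ι² ψ` for `x ∈ S` (`ladder_wave`); moreover `∂ₜ` commutes with the ladder
(`deriv_ladder_param`), so the Cauchy data of `ψ` are the ladders of the data of `Φ`
(`ladder_wave_data`). With `Φ` the d'Alembert solution this is the explicit solution theory of the
exact inverse-square wave equation `ψ_tt − ψ_xx + ℓ(ℓ+1)x⁻²ψ = 0` on a half-line cone
(Kenig–Lawrie–Liu–Schlag 2015 §2, in 1D form) — the far-side comparison dynamics of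
`FixedModeChannels` (route PhotonSphereChannels, stmt-FinalStateConjecture-10048).
-/

noncomputable section

namespace Literature.Analysis.PDE

open Set Filter Topology Literature.Analysis.ODE

variable {ι : ℝ → ℝ}

/-- **`∂ₜ` commutes with the ladder**: for `uncurry Φ ∈ C^{n+2}`,
`∂ₜ (ladder ι n (Φ t)) (x) = ladder ι n (∂ₜΦ(t,·)) (x)`. [folklore] -/
theorem deriv_ladder_param (hι : ContDiff ℝ (⊤ : ℕ∞) ι) {n : ℕ} {Φ : ℝ → ℝ → ℝ}
    (hΦ : ContDiff ℝ ((n + 2 : ℕ) : ℕ∞) (Function.uncurry Φ)) (t x : ℝ) :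
    deriv (fun τ => ladder ι n (Φ τ) x) t = ladder ι n (fun y => deriv (fun τ => Φ τ y) t) x := by
  induction n generalizing x with
  | zero => simp
  | succ n ih =>
    have hΦn : ContDiff ℝ ((n + 2 : ℕ) : ℕ∞) (Function.uncurry Φ) :=
      hΦ.of_le (by exact_mod_cast (by omega : n + 2 ≤ n + 1 + 2))
    -- level-`n` family is `C²`
    have hψ2 : ContDiff ℝ 2 (Function.uncurry fun t => ladder ι n (Φ t)) :=
      contDiff_uncurry_ladder hι (m := 2) (by
        have : 2 + n = n + 2 := by ring
        rw [this]; exact hΦn)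
    have hψ2' : ContDiff ℝ 2 (Function.uncurry fun t => ladder ι n (Φ t)) := hψ2
    show deriv (fun τ => ladderStep ι (n + 1) (ladder ι n (Φ τ)) x) t
      = ladderStep ι (n + 1) (ladder ι n fun y => deriv (fun τ => Φ τ y) t) x
    rw [deriv_ladderStep_param (Φ := fun t => ladder ι n (Φ t)) hψ2' (n + 1) t x]
    congr 1
    funext y
    exact ih hΦn y

/-- **The ladder of a free wave solves the level-`n` equation on `S`** and is jointly `C²`.
[folklore] -/
theorem ladder_wave (hι : ContDiff ℝ (⊤ : ℕ∞) ι) {S : Set ℝ} (hS : IsOpen S)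
    (hι' : ∀ x ∈ S, deriv ι x = -(ι x) ^ 2) {n : ℕ} {Φ : ℝ → ℝ → ℝ}
    (hΦ : ContDiff ℝ ((n + 2 : ℕ) : ℕ∞) (Function.uncurry Φ))
    (hfree : ∀ t x, iteratedDeriv 2 (fun τ => Φ τ x) t = iteratedDeriv 2 (Φ t) x) :
    ContDiff ℝ 2 (Function.uncurry fun t => ladder ι n (Φ t)) ∧
      ∀ t, ∀ x ∈ S, iteratedDeriv 2 (fun τ => ladder ι n (Φ τ) x) t
        = iteratedDeriv 2 (ladder ι n (Φ t)) x - n * (n + 1) * ι x ^ 2 * ladder ι n (Φ t) x := by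
  induction n with
  | zero =>
    refine ⟨by simpa using hΦ, fun t x _ => ?_⟩
    simp [hfree t x]
  | succ n ih =>
    have hΦn : ContDiff ℝ ((n + 2 : ℕ) : ℕ∞) (Function.uncurry Φ) :=
      hΦ.of_le (by exact_mod_cast (by omega : n + 2 ≤ n + 1 + 2))
    obtain ⟨-, hsoln⟩ := ih hΦn
    -- the level-`n` family is `C³`
    have hψ3 : ContDiff ℝ 3 (Function.uncurry fun t => ladder ι n (Φ t)) :=
      contDiff_uncurry_ladder hι (m := 3) (by
        have : 3 + n = n + 1 + 2 := by ring
        rw [this]; exact hΦ)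
    have hsol' : ∀ t, ∀ x ∈ S, iteratedDeriv 2 (fun τ => ladder ι n (Φ τ) x) t
        = iteratedDeriv 2 (ladder ι n (Φ t)) x
          - (((n + 1 : ℕ) : ℝ) - 1) * ((n + 1 : ℕ) : ℝ) * ι x ^ 2 * ladder ι n (Φ t) x := by
      intro t x hx; rw [hsoln t x hx]; push_cast; ring
    obtain ⟨ψ, hψdef, hψC2, hψsol⟩ :=
      wave1D_intertwine (φ := fun t => ladder ι n (Φ t)) hψ3 (by exact_mod_cast contDiff_infty.1 hι 2)
        ((n + 1 : ℕ) : ℝ) hS hι' hsol'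
    have hψeq : ψ = fun t => ladder ι (n + 1) (Φ t) := by
      funext t x
      rw [hψdef t x, ladder_succ, ladderStep_apply]
    subst hψeq
    refine ⟨hψC2, fun t x hx => ?_⟩
    exact_mod_cast hψsol t x hx

/-- **Data of the ladder solution**: `ψ(0,·) = ladder ι n (Φ(0,·))` (definitional) and
`∂ₜψ(0,·) = ladder ι n (∂ₜΦ(0,·))`. [folklore] -/
theorem ladder_wave_data (hι : ContDiff ℝ (⊤ : ℕ∞) ι) {n : ℕ} {Φ : ℝ → ℝ → ℝ}
    (hΦ : ContDiff ℝ ((n + 2 : ℕ) : ℕ∞) (Function.uncurry Φ)) (x : ℝ) :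
    (fun t => ladder ι n (Φ t)) 0 x = ladder ι n (Φ 0) x ∧
      deriv (fun τ => ladder ι n (Φ τ) x) 0 = ladder ι n (fun y => deriv (fun τ => Φ τ y) 0) x :=
  ⟨rfl, deriv_ladder_param hι hΦ 0 x⟩

end Literature.Analysis.PDE
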